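/-
Copyright (c) 2026. All rights reserved.
Released under Apache 2.0 license as described in the file LICENSE.
Authors: abc-iut cell, prover seat abc-iut-w4-d095 (gen 7; row «SB′-CONTACT», abc-iut-L4-lead m136), over abc-iut-L4-t3's
`LogFrobeniusIotaAnMonoChains` / `LogFrobeniusIotaEtaSquare` / `LogFrobeniusIotaOver` and abc-iut-f-101's
`LogFrobeniusObservablesOfIotaSquare` (statements and toolkits; nothing of those files is restated).
-/
import Literature.AnabelianGeometry.AbsoluteAnabelian.LogFrobeniusIotaAnMonoChains
import Literature.AnabelianGeometry.AbsoluteAnabelian.LogFrobeniusObservablesOfIotaSquare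
import Literature.AnabelianGeometry.AbsoluteAnabelian.LogFrobeniusIotaOver
import HarnessLib

/-!
# [AbsTopIII] Cor 5.5 (iii) / Cor 5.10 (iv)(c): the `ι⊞_{v,ε}` composed along `Γ⃗×_v`, over `Th•[Z]`, and the `η⊢`-square along chains

S. Mochizuki, *Topics in absolute anabelian geometry III: global reconstruction algorithms*,
J. Math. Sci. Univ. Tokyo 22 (2015) 939–1156 [MochizukiAbsTopIII2015]; manuscript `paper:url-5493eb38cbb7`: Def 5.4 (iii)
p. 126 (`Γ⃗×_v`, the COMMUTATIVE square `𝒪^× ↪ k̄^× → (k̄^×)^pf` / `𝒪^× → k~ ↪ (k̄^×)^pf`), (vii) p. 128 (`ι⊞_{v,ε}`), Cor 5.5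
(iii) p. 131 (the observable `S_log⊞`: ONE homotopy per pair of its saturated boundary set), Cor 5.10 (iv)(c) p. 148
(`η⊢_{v,ν}`; the contact structure `ℋ_{An⊢}` "compatible … with the homotopies of the observables `S_log`, `S_log⊞` … that
arise from the `ι⊞_{v,ε}`, `ι_{v,ε}` indexed by `ε ∈ Γ⃗×_v`"), Def 3.5 (ii) p. 75 / §0 p. 26 (saturation: transitivity).

WHY THIS FILE (row «SB′-CONTACT», first brick; PROOF-SIDE support, nothing of the interface restated).  A family of
homotopies containing the `ι⊞`-pairs `([λ⊞_{v,ν₁}], [λ⊞_{v,ν₂}])` of `S_log⊞` indexed by the edges of `Γ⃗×_v` contains, by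
transitivity, the pair `([λ⊞_{v,ν₁}], [λ⊞_{v,ν₃}])` for every `ν₃` REACHABLE from `ν₁` in `Γ⃗×_v`, with homotopy the composite
of the `ι⊞` along the way.  This file supplies those composites and their laws, in parallel with abc-iut-L4-t3's
`IotaAnMono.chain` for the `ι^{An⊢⊞}` (both are instances of abc-iut-L4-t3's generic `LogVertex.reachChain`):

* `lamChain L v h : λ⊞_{v,ν₁} ⟶ λ⊞_{v,ν₂}` for `h : ν₁ ⤳ ν₂` — the composite of abc-iut-L4-t3's untwisted `iotaCore` along the
  reachability; `lamChain_refl`, `lamChain_inCore`, `lamChain_trans` (UNDER `IotaCoreSquaresCommute`);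
* `IotaCoreSquaresCommute L v` — the `ι⊞`-square of Def 5.4 (iii) for the untwisted `ι⊞` (abc-iut-L4-t3's
  `LogVertex.SquaresCommuteF` read for `ι⊞`); it FOLLOWS from abc-iut-f-101's `IotaSquaresCommute`
  (`iotaCoreSquaresCommute_of_iotaSquaresCommute`), hence from any observable structure `S_log⊞` at `v`
  (`iotaCoreSquaresCommute_of_isLogObservablePlus`, abc-iut-f-101's `iotaSquaresCommute_of_isLogObservablePlus`);
* `iotaCore_over_app`, `lamChain_over_app` — GIVEN abc-iut-L4-t3's add-on `IotaOver` ("the `ι⊞` lie over `Th•[Z]`"), the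
  untwisted `ι⊞_{v,ε}` and its composites along `Γ⃗×_v` lie over `Th•[Z]`: their image under `𝒩⊞_v → 𝒩_v → Th•[Z]` is
  "`λ⊞_{v,ν₁}` lies over" followed by "(`λ⊞_{v,ν₂}` lies over)⁻¹";
* `LogVertex.reachChain_induction₂` — joint induction along reachability for TWO families of edge data (generic);
* ★ `IotaAnMono.etaNaturalAt_chain` — **the `η⊢`-square along CHAINS**: abc-iut-L4-t3's edge-indexed square `EtaNaturalAt`
  (`η⊢_{v,ν₁} ≫ (ι⊞ mono-analyticised) = (ι⊞ transported ≫ ι^{An⊢⊞}) ≫ η⊢_{v,ν₂}`) pastes to the same square for `lamChain` /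
  `IotaAnMono.chain` along every `ν₁ ⤳ ν₂` (identities on the diagonal; pasting by naturality of `ι^{An⊢⊞}`).

Consumer: `LogFrobeniusMonoTelecoreContactObservables.lean` (the closer of abc-iut-w5-d144's typed
`Cor510MonoContactObservablesCompatible`, p484312).  Refereed pre-IUT material; OUR constructions over a typed interface and
its typed add-ons (`IotaOver`, `IotaAnMono`, `EtaNaturalAt` are HYPOTHESES where used); nothing here bears on [IUTchIII]
Cor. 3.12; no side taken; typed ≠ proved.
-/

set_option autoImplicit false

universe u

open CategoryTheory

namespace Literature.AnabelianGeometry.AbsoluteAnabelian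

/-! ## Joint induction along reachability for two families of edge data (generic) -/

section Induction₂

variable {C : Type*} [Category C] {C' : Type*} [Category C'] {b : Bool}
  (F : {ν : LogVertex b // ν.IsCross} → C)
  (ιF : ∀ {μ₁ μ₂ : LogVertex b} (ε : LogEdgeTS b μ₁ μ₂) (hε : ε.InCore), F ⟨μ₁, hε.isCross_src⟩ ⟶ F ⟨μ₂, hε.isCross_tgt⟩)
  (G : {ν : LogVertex b // ν.IsCross} → C')
  (ιG : ∀ {μ₁ μ₂ : LogVertex b} (ε : LogEdgeTS b μ₁ μ₂) (hε : ε.InCore), G ⟨μ₁, hε.isCross_src⟩ ⟶ G ⟨μ₂, hε.isCross_tgt⟩)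

/-- **joint induction along reachability**: a property of PAIRS of morphisms (between the `F`'s, between the `G`'s) that holds
for the pair of identities and for the pair of edge data of every edge of `Γ⃗×_v`, and is closed under simultaneous composition,
holds for the pair of composites along every `ν₁ ⤳ ν₂` (abc-iut-L4-t3's `reachChain_induction` for two families at once: both
composites are built by the same case tree). [cite: MochizukiAbsTopIII2015, Def 5.4 (iii) p. 126] -/
theorem LogVertex.reachChain_induction₂
    (P : ∀ ⦃j₁ j₂ : {ν : LogVertex b // ν.IsCross}⦄, (F j₁ ⟶ F j₂) → (G j₁ ⟶ G j₂) → Prop)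
    (hid : ∀ j, P (𝟙 (F j)) (𝟙 (G j)))
    (hcomp : ∀ ⦃j₁ j₂ j₃ : {ν : LogVertex b // ν.IsCross}⦄ (f : F j₁ ⟶ F j₂) (f' : F j₂ ⟶ F j₃) (g : G j₁ ⟶ G j₂)
      (g' : G j₂ ⟶ G j₃), P f g → P f' g' → P (f ≫ f') (g ≫ g'))
    (hι : ∀ ⦃μ₁ μ₂ : LogVertex b⦄ (ε : LogEdgeTS b μ₁ μ₂) (hε : ε.InCore), P (ιF ε hε) (ιG ε hε))
    {ν₁ ν₂ : LogVertex b} (h : ν₁.Reach ν₂) :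
    P (LogVertex.reachChain b F ιF ν₁ ν₂ h) (LogVertex.reachChain b G ιG ν₁ ν₂ h) := by
  cases b <;> cases ν₁ <;> cases ν₂ <;>
    first
      | exact absurd h (by decide)
      | exact hid _
      | exact hcomp _ _ _ _ (hι _ _) (hι _ _)
      | exact hι _ _

end Induction₂

namespace LogFrobeniusSetting

variable {Vmod : Type u} {isArc : Vmod → Bool} (L : LogFrobeniusSetting Vmod isArc)

/-! ## `ι⊞` composed along `ν₁ ⤳ ν₂` -/

/-- **`ι⊞_v` along `ν₁ ⤳ ν₂`**: the composite natural transformation `λ⊞_{v,ν₁} ⟶ λ⊞_{v,ν₂}` of the (untwisted) `ι⊞_{v,ε}` along the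
reachability in `Γ⃗×_v` — the homotopy of the pair `([λ⊞_{v,ν₁}], [λ⊞_{v,ν₂}])` in any family of homotopies containing the
`ι⊞`-pairs of `S_log⊞` indexed by the edges of `Γ⃗×_v` (Def 3.5 (ii): transitive, one homotopy per pair).
[cite: MochizukiAbsTopIII2015, Cor 5.5 (iii) p. 131] -/
def lamChain (v : Vmod) {ν₁ ν₂ : LogVertex (isArc v)} (h : ν₁.Reach ν₂) : L.lam v ν₁ ⟶ L.lam v ν₂ :=
  LogVertex.reachChain (isArc v) (fun j => L.lam v j.1) (fun ε hε => L.iotaCore v ε hε) ν₁ ν₂ h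

/-- **The `ι⊞`-square of Def 5.4 (iii)** for the untwisted `ι⊞` (a CONDITION on `L` at `v`: the two composites
`λ⊞_{𝒪^×} ⟶ λ⊞_{(k̄^×)^pf}` through `k̄^×` and through `k~` agree; vacuous at an archimedean place).
[cite: MochizukiAbsTopIII2015, Def 5.4 (iii) p. 126] -/
def IotaCoreSquaresCommute (v : Vmod) : Prop :=
  LogVertex.SquaresCommuteF (isArc v) (fun j => L.lam v j.1) (fun ε hε => L.iotaCore v ε hε)

/-- on the diagonal `ι⊞` along `ν ⤳ ν` is the identity. [cite: MochizukiAbsTopIII2015, Cor 5.5 (iii) p. 131] -/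
theorem lamChain_refl (v : Vmod) {ν : LogVertex (isArc v)} (h : ν.Reach ν) : L.lamChain v h = 𝟙 _ :=
  LogVertex.reachChain_refl _ _ h

/-- along an edge of `Γ⃗×_v` it is the untwisted `ι⊞_{v,ε}` itself. [cite: MochizukiAbsTopIII2015, Def 5.4 (vii) p. 128] -/
theorem lamChain_inCore (v : Vmod) {ν₁ ν₂ : LogVertex (isArc v)} (ε : LogEdgeTS (isArc v) ν₁ ν₂) (hε : ε.InCore) :
    L.lamChain v (LogVertex.Reach.of_inCore hε) = L.iotaCore v ε hε :=
  LogVertex.reachChain_inCore _ _ ε hε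

/-- **transitivity of the composites under the square** (`ι⊞` along `ν₁ ⤳ ν₂ ⤳ ν₃` is `ι⊞` along `ν₁ ⤳ ν₃`).
[cite: MochizukiAbsTopIII2015, Cor 5.5 (iii) p. 131] -/
theorem lamChain_trans (v : Vmod) (hsq : L.IotaCoreSquaresCommute v) {ν₁ ν₂ ν₃ : LogVertex (isArc v)}
    (h₁₂ : ν₁.Reach ν₂) (h₂₃ : ν₂.Reach ν₃) (h₁₃ : ν₁.Reach ν₃) :
    L.lamChain v h₁₂ ≫ L.lamChain v h₂₃ = L.lamChain v h₁₃ :=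
  LogVertex.reachChain_trans _ _ hsq h₁₂ h₂₃ h₁₃

/-- componentwise transitivity. [cite: MochizukiAbsTopIII2015, Cor 5.5 (iii) p. 131] -/
theorem lamChain_trans_app (v : Vmod) (hsq : L.IotaCoreSquaresCommute v) {ν₁ ν₂ ν₃ : LogVertex (isArc v)}
    (h₁₂ : ν₁.Reach ν₂) (h₂₃ : ν₂.Reach ν₃) (h₁₃ : ν₁.Reach ν₃) (y : L.X) :
    (L.lamChain v h₁₂).app y ≫ (L.lamChain v h₂₃).app y = (L.lamChain v h₁₃).app y := by
  rw [← NatTrans.comp_app, L.lamChain_trans v hsq h₁₂ h₂₃ h₁₃]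

/-- naturality of the composite, componentwise. [cite: MochizukiAbsTopIII2015, Def 5.4 (vii) p. 128] -/
theorem lamChain_naturality (v : Vmod) {ν₁ ν₂ : LogVertex (isArc v)} (h : ν₁.Reach ν₂) {y y' : L.X} (f : y ⟶ y') :
    (L.lam v ν₁).map f ≫ (L.lamChain v h).app y' = (L.lamChain v h).app y ≫ (L.lam v ν₂).map f :=
  (L.lamChain v h).naturality f

/-! ## The square from `IotaSquaresCommute`, hence from any observable structure `S_log⊞` -/

/-- **abc-iut-f-101's `IotaSquaresCommute` (componentwise, `HEq`-bound form) gives the square for the untwisted `ι⊞`**: the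
bound components are the components of `iotaCore` (abc-iut-L4-t3's `iotaPre_app_heq`).
[cite: MochizukiAbsTopIII2015, Def 5.4 (iii) p. 126] -/
theorem iotaCoreSquaresCommute_of_iotaSquaresCommute (v : Vmod) (hsq : L.IotaSquaresCommute v) :
    L.IotaCoreSquaresCommute v := by
  -- reduce to a statement about a general Boolean kind of place
  suffices key : ∀ (b : Bool) (F : {ν : LogVertex b // ν.IsCross} → (L.X ⥤ L.Nplus v))
      (ιF : ∀ {μ₁ μ₂ : LogVertex b} (ε : LogEdgeTS b μ₁ μ₂) (hε : ε.InCore), F ⟨μ₁, hε.isCross_src⟩ ⟶ F ⟨μ₂, hε.isCross_tgt⟩),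
      (∀ {ν₁ ν₂ ν₂' ν₃ : LogVertex b} (ε₁₂ : LogEdgeTS b ν₁ ν₂) (h₁₂ : ε₁₂.InCore) (ε₂₃ : LogEdgeTS b ν₂ ν₃)
        (h₂₃ : ε₂₃.InCore) (ε₁₂' : LogEdgeTS b ν₁ ν₂') (h₁₂' : ε₁₂'.InCore) (ε₂'₃ : LogEdgeTS b ν₂' ν₃)
        (h₂'₃ : ε₂'₃.InCore), ιF ε₁₂ h₁₂ ≫ ιF ε₂₃ h₂₃ = ιF ε₁₂' h₁₂' ≫ ιF ε₂'₃ h₂'₃) →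
      LogVertex.SquaresCommuteF b F ιF from
    key (isArc v) _ _ (fun ε₁₂ h₁₂ ε₂₃ h₂₃ ε₁₂' h₁₂' ε₂'₃ h₂'₃ => by
      ext y
      rw [NatTrans.comp_app, NatTrans.comp_app]
      exact hsq h₁₂.isCross_src.1 h₁₂.isCross_tgt.1 h₁₂'.isCross_tgt.1 h₂₃.isCross_tgt.1 h₁₂.toLogEdge h₂₃.toLogEdge
        h₁₂'.toLogEdge h₂'₃.toLogEdge y _ _ _ _ (L.iotaPre_app_heq v _ _ y) (L.iotaPre_app_heq v _ _ y)
        (L.iotaPre_app_heq v _ _ y) (L.iotaPre_app_heq v _ _ y))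
  intro b F ιF hc
  cases b
  · exact hc NonarchEdge.shell NonarchEdge.inCore_shell NonarchEdge.shellCodToPerf NonarchEdge.inCore_of_ne.2.2
      NonarchEdge.unitsToMult NonarchEdge.inCore_of_ne.1 NonarchEdge.multToPerf NonarchEdge.inCore_of_ne.2.1
  · trivial

/-- **any observable structure `S_log⊞` at `v` gives the square** (abc-iut-f-101: the observable forces `IotaSquaresCommute`).
[cite: MochizukiAbsTopIII2015, Cor 5.5 (iii) p. 131] -/
theorem iotaCoreSquaresCommute_of_isLogObservablePlus (v : Vmod) (H : (L.logDiagramPlus v).HomotopyFamily)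
    (hH : L.IsLogObservablePlus v H) : L.IotaCoreSquaresCommute v :=
  L.iotaCoreSquaresCommute_of_iotaSquaresCommute v (L.iotaSquaresCommute_of_isLogObservablePlus v H hH)

/-! ## Over `Th•[Z]` -/

/-- at a pre-log vertex "`λ⊞_{v,ν} ∘ Λ_ν` lies over `Th•[Z]`" is "`λ⊞_{v,ν}` lies over `Th•[Z]`" (`Λ_ν = 𝟭`), componentwise up to the
cast of the source. [cite: MochizukiAbsTopIII2015, Def 5.4 (vii) p. 128] -/
theorem lamTwistOver_hom_app_heq (v : Vmod) (ν : LogVertex (isArc v)) (hν : ν.isPostLog = false) (y : L.X) :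
    (L.lamTwistOver v ν).hom.app y ≍ (L.lamOver v ν).hom.app y := by
  -- generalise the Boolean "is post-log" and the functor `λ⊞_{v,ν}`
  suffices key : ∀ (b : Bool) (_ : b = false) (F : L.X ⥤ L.Nplus v) (e : F ⋙ L.forget v ⋙ L.toE v ≅ L.proj),
      (Functor.associator _ _ _ ≪≫ Functor.isoWhiskerLeft (frobeniusTwist L.log b) e ≪≫ L.twistOver b).hom.app y ≍
        e.hom.app y from
    key ν.isPostLog hν (L.lam v ν) (L.lamOver v ν)
  rintro b rfl F e
  refine heq_of_eq ?_
  rw [Iso.trans_hom, Iso.trans_hom, NatTrans.comp_app, NatTrans.comp_app, twistOver_false]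
  erw [Functor.associator_hom_app, Functor.whiskerLeft_app, Functor.leftUnitor_hom_app, Category.id_comp,
    Category.comp_id]
  try rfl

/-- functors respect `HEq` of morphisms with (propositionally) equal sources (bookkeeping for the cast `Λ_ν = 𝟭`).
[cite: MochizukiAbsTopIII2015, Def 5.4 (vii) p. 128] -/
theorem map_map_heq_of_heq {A B C : Type*} [Category A] [Category B] [Category C] (F : A ⥤ B) (G : B ⥤ C)
    {X X' Y : A} (hX : X = X') {f : X ⟶ Y} {f' : X' ⟶ Y} (h : f ≍ f') : G.map (F.map f) ≍ G.map (F.map f') := by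
  subst hX
  cases h
  rfl

/-- **the untwisted `ι⊞_{v,ε}` along an edge of `Γ⃗×_v` lies over `Th•[Z]`**, GIVEN abc-iut-L4-t3's add-on `IotaOver`: its image under
`𝒩⊞_v → 𝒩_v → Th•[Z]` is "`λ⊞_{v,ν₁}` lies over" at `y` followed by "(`λ⊞_{v,ν₂}` lies over)⁻¹" at `y`.
[cite: MochizukiAbsTopIII2015, Def 5.4 (vii) p. 128] -/
theorem iotaCore_over_app (hιO : L.IotaOver) (v : Vmod) {ν₁ ν₂ : LogVertex (isArc v)} (ε : LogEdgeTS (isArc v) ν₁ ν₂)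
    (hε : ε.InCore) (y : L.X) :
    (L.toE v).map ((L.forget v).map ((L.iotaCore v ε hε).app y)) =
      (L.lamOver v ν₁).hom.app y ≫ (L.lamOver v ν₂).inv.app y := by
  have h₁ : ν₁.isPostLog = false := hε.isCross_src.1
  -- the cast of the source object (`Λ_{ν₁} = 𝟭` at the pre-log vertex `ν₁`)
  have hobj : (L.lam v ν₁).obj y = (frobeniusTwist L.log ν₁.isPostLog ⋙ L.lam v ν₁).obj y :=
    congrArg (fun F => F.obj y) (L.twist_comp_lam_eq v ν₁ h₁).symm
  -- untwisted component ≍ interface component, pushed down to `Th•[Z]`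
  have hmap : (L.toE v).map ((L.forget v).map ((L.iotaCore v ε hε).app y)) ≍
      (L.toE v).map ((L.forget v).map ((L.iota v hε.toLogEdge).app y)) :=
    map_map_heq_of_heq (L.forget v) (L.toE v) hobj (L.iotaPre_app_heq v hε.toLogEdge h₁ y)
  apply eq_of_heq
  refine hmap.trans ?_
  rw [IotaOver.app hιO v hε.toLogEdge y]
  exact heq_comp (congrArg (fun X => (L.toE v).obj ((L.forget v).obj X)) hobj.symm) rfl rfl
    (L.lamTwistOver_hom_app_heq v ν₁ h₁ y) HEq.rfl

/-- **`ι⊞` along `ν₁ ⤳ ν₂` lies over `Th•[Z]`** (GIVEN `IotaOver`): componentwise, its image under `𝒩⊞_v → 𝒩_v → Th•[Z]` is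
"`λ⊞_{v,ν₁}` lies over" followed by "(`λ⊞_{v,ν₂}` lies over)⁻¹" (induction along the reachability).
[cite: MochizukiAbsTopIII2015, Def 5.4 (vii) p. 128] -/
theorem lamChain_over_app (hιO : L.IotaOver) (v : Vmod) {ν₁ ν₂ : LogVertex (isArc v)} (h : ν₁.Reach ν₂) (y : L.X) :
    (L.toE v).map ((L.forget v).map ((L.lamChain v h).app y)) =
      (L.lamOver v ν₁).hom.app y ≫ (L.lamOver v ν₂).inv.app y := by
  refine LogVertex.reachChain_induction (b := isArc v) (fun j => L.lam v j.1) (fun ε hε => L.iotaCore v ε hε)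
    (fun j₁ j₂ f => ∀ y : L.X,
      (L.toE v).map ((L.forget v).map (f.app y)) = (L.lamOver v j₁.1).hom.app y ≫ (L.lamOver v j₂.1).inv.app y)
    (fun j y => ?_) (fun j₁ j₂ j₃ f g hf hg y => ?_) (fun μ₁ μ₂ ε hε y => L.iotaCore_over_app hιO v ε hε y) h y
  · rw [NatTrans.id_app, CategoryTheory.Functor.map_id, CategoryTheory.Functor.map_id, Iso.hom_inv_id_app]
    rfl
  · have key : ((L.lamOver v j₁.1).hom.app y ≫ (L.lamOver v j₂.1).inv.app y) ≫
        (L.lamOver v j₂.1).hom.app y ≫ (L.lamOver v j₃.1).inv.app y =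
        (L.lamOver v j₁.1).hom.app y ≫ (L.lamOver v j₃.1).inv.app y := by
      rw [Category.assoc, Iso.inv_hom_id_app_assoc]
    rw [NatTrans.comp_app, Functor.map_comp, Functor.map_comp, hf y, hg y]
    exact key

/-! ## The `η⊢`-square along chains -/

namespace IotaAnMono

variable {L}
variable {hψ : ∀ (w : Vmod) (j : {ν : LogVertex (isArc w) // ν.IsCross}),
  L.ψAnMono w j ⋙ L.forgetMono w ⋙ L.toEmono w ≅ L.κAnMono.inverse}
variable (I : L.IotaAnMono hψ)
variable {η : ∀ (v : Vmod) (ν : LogVertex (isArc v)) (hν : ν.IsCross),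
  L.lam v ν ⋙ L.forget v ⋙ L.toE v ⋙ L.monoAn ⋙ L.κAnMono.functor ⋙ L.ψAnMono v ⟨ν, hν⟩ ≅ L.lam v ν ⋙ L.monoNplus v}

/-- **the `γ¹`-side homotopy** (as ONE natural transformation between the functors of the paths `γ¹_{v,ν₁}`, `γ¹_{v,ν₂}`)
determined by a homotopy `f : λ⊞_{v,ν₁} ⟶ λ⊞_{v,ν₂}` and a homotopy `g : ψ^{An⊢⊞}_{v,ν₁} ⟶ ψ^{An⊢⊞}_{v,ν₂}`: `f` whiskered along
`𝒩⊞_v → 𝒩_v → ℰ• → ℰ⊢ ⥲ An⊢ →(ψ^{An⊢⊞}_{v,ν₁})`, then `g` whiskered by `λ⊞_{v,ν₂} ⋙ ⋯ ⋙ (ℰ⊢ ⥲ An⊢)` (Def 3.5 (ii) (d), (e), (c); its components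
are abc-iut-L4-t3's `gammaOneApp` for the pair `(ι⊞_{v,ε}, ι^{An⊢⊞}_{v,ε})`, `gammaOneOf_iota_app`).
[cite: MochizukiAbsTopIII2015, Cor 5.10 (iv)(c) p. 148] -/
def gammaOneOf (v : Vmod) {ν₁ ν₂ : LogVertex (isArc v)} {hν₁ : ν₁.IsCross} {hν₂ : ν₂.IsCross}
    (f : L.lam v ν₁ ⟶ L.lam v ν₂) (g : L.ψAnMono v ⟨ν₁, hν₁⟩ ⟶ L.ψAnMono v ⟨ν₂, hν₂⟩) :
    L.lam v ν₁ ⋙ L.forget v ⋙ L.toE v ⋙ L.monoAn ⋙ L.κAnMono.functor ⋙ L.ψAnMono v ⟨ν₁, hν₁⟩ ⟶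
      L.lam v ν₂ ⋙ L.forget v ⋙ L.toE v ⋙ L.monoAn ⋙ L.κAnMono.functor ⋙ L.ψAnMono v ⟨ν₂, hν₂⟩ :=
  Functor.whiskerRight f (L.forget v ⋙ L.toE v ⋙ L.monoAn ⋙ L.κAnMono.functor ⋙ L.ψAnMono v ⟨ν₁, hν₁⟩) ≫
    Functor.whiskerLeft (L.lam v ν₂) (Functor.whiskerLeft (L.forget v) (Functor.whiskerLeft (L.toE v)
      (Functor.whiskerLeft L.monoAn (Functor.whiskerLeft L.κAnMono.functor g))))

omit I in
/-- components of the `γ¹`-side homotopy: `f_y` transported, then `g` at the transport of `λ⊞_{v,ν₂}(y)`.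
[cite: MochizukiAbsTopIII2015, Cor 5.10 (iv)(c) p. 148] -/
theorem gammaOneOf_app (v : Vmod) {ν₁ ν₂ : LogVertex (isArc v)} {hν₁ : ν₁.IsCross} {hν₂ : ν₂.IsCross}
    (f : L.lam v ν₁ ⟶ L.lam v ν₂) (g : L.ψAnMono v ⟨ν₁, hν₁⟩ ⟶ L.ψAnMono v ⟨ν₂, hν₂⟩) (y : L.X) :
    (gammaOneOf (L := L) v f g).app y =
      (L.ψAnMono v ⟨ν₁, hν₁⟩).map ((L.forget v ⋙ L.toE v ⋙ L.monoAn ⋙ L.κAnMono.functor).map (f.app y)) ≫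
        g.app ((L.lam v ν₂ ⋙ L.forget v ⋙ L.toE v ⋙ L.monoAn ⋙ L.κAnMono.functor).obj y) := rfl

omit I in
/-- on the pair of identities. [cite: MochizukiAbsTopIII2015, Cor 5.10 (iv)(c) p. 148] -/
theorem gammaOneOf_id (v : Vmod) (ν : LogVertex (isArc v)) (hν : ν.IsCross) :
    gammaOneOf (L := L) v (hν₁ := hν) (hν₂ := hν) (𝟙 (L.lam v ν)) (𝟙 (L.ψAnMono v ⟨ν, hν⟩)) = 𝟙 _ := by
  unfold gammaOneOf
  simp only [Functor.whiskerRight_id', Functor.whiskerLeft_id', Category.comp_id]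

omit I in
/-- on a pair of composites (Def 3.5 (ii) `ζ_{ϖ″} = ζ_{ϖ′} ∘ ζ_ϖ`; the exchange of the two whiskerings is the naturality of the
`ψ`-side homotopy). [cite: MochizukiAbsTopIII2015, Definition 3.5 (ii) p. 75] -/
theorem gammaOneOf_comp (v : Vmod) {ν₁ ν₂ ν₃ : LogVertex (isArc v)} {hν₁ : ν₁.IsCross} {hν₂ : ν₂.IsCross}
    {hν₃ : ν₃.IsCross} (f : L.lam v ν₁ ⟶ L.lam v ν₂) (f' : L.lam v ν₂ ⟶ L.lam v ν₃)
    (g : L.ψAnMono v ⟨ν₁, hν₁⟩ ⟶ L.ψAnMono v ⟨ν₂, hν₂⟩) (g' : L.ψAnMono v ⟨ν₂, hν₂⟩ ⟶ L.ψAnMono v ⟨ν₃, hν₃⟩) :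
    gammaOneOf (L := L) v (f ≫ f') (g ≫ g') = gammaOneOf (L := L) v f g ≫ gammaOneOf (L := L) v f' g' := by
  unfold gammaOneOf
  simp only [Functor.whiskerRight_comp, Functor.whiskerLeft_comp, Category.assoc]
  congr 1
  rw [← Category.assoc, ← Functor.whiskerLeft_comp_whiskerRight, Category.assoc]

/-- along an edge the components of the `γ¹`-side homotopy of `(ι⊞_{v,ε}, ι^{An⊢⊞}_{v,ε})` are abc-iut-L4-t3's `gammaOneApp`.
[cite: MochizukiAbsTopIII2015, Cor 5.10 (iv)(c) p. 148] -/
theorem gammaOneOf_iota_app (v : Vmod) {ν₁ ν₂ : LogVertex (isArc v)} (ε : LogEdgeTS (isArc v) ν₁ ν₂) (hε : ε.InCore)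
    (y : L.X) : (gammaOneOf (L := L) v (L.iotaCore v ε hε) (I.ι v ε hε)).app y = I.gammaOneApp v ε hε y := rfl

/-- abc-iut-L4-t3's edge-indexed square as ONE equation of natural transformations (from the componentwise `EtaNaturalAt`).
[cite: MochizukiAbsTopIII2015, Cor 5.10 (iv)(c) p. 148] -/
theorem etaNaturalAt_natTrans (hEta : I.EtaNaturalAt η) (v : Vmod) {ν₁ ν₂ : LogVertex (isArc v)}
    (ε : LogEdgeTS (isArc v) ν₁ ν₂) (hε : ε.InCore) :
    (η v ν₁ hε.isCross_src).hom ≫ Functor.whiskerRight (L.iotaCore v ε hε) (L.monoNplus v) =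
      gammaOneOf (L := L) v (L.iotaCore v ε hε) (I.ι v ε hε) ≫ (η v ν₂ hε.isCross_tgt).hom := by
  ext y
  exact hEta v ε hε y

/-- **the `γ¹`-side homotopy along a CHAIN `ν₁ ⤳ ν₂`**: the pair (`ι⊞` along the chain, `ι^{An⊢⊞}` along the chain).
[cite: MochizukiAbsTopIII2015, Cor 5.10 (iv)(c) p. 148] -/
def gammaOneChain (v : Vmod) {ν₁ ν₂ : LogVertex (isArc v)} (h : ν₁.Reach ν₂) :
    L.lam v ν₁ ⋙ L.forget v ⋙ L.toE v ⋙ L.monoAn ⋙ L.κAnMono.functor ⋙ L.ψAnMono v ⟨ν₁, h.isCross_src⟩ ⟶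
      L.lam v ν₂ ⋙ L.forget v ⋙ L.toE v ⋙ L.monoAn ⋙ L.κAnMono.functor ⋙ L.ψAnMono v ⟨ν₂, h.isCross_tgt⟩ :=
  gammaOneOf (L := L) v (L.lamChain v h) (I.chain v h)

/-- its components: `ι⊞` along the chain transported along `𝒩⊞_v → 𝒩_v → ℰ• → ℰ⊢ ⥲ An⊢ →(ψ^{An⊢⊞}_{v,ν₁})`, followed by `ι^{An⊢⊞}`
along the chain at the transport of `λ⊞_{v,ν₂}(y)`. [cite: MochizukiAbsTopIII2015, Cor 5.10 (iv)(c) p. 148] -/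
theorem gammaOneChain_app (v : Vmod) {ν₁ ν₂ : LogVertex (isArc v)} (h : ν₁.Reach ν₂) (y : L.X) :
    (I.gammaOneChain v h).app y =
      (L.ψAnMono v ⟨ν₁, h.isCross_src⟩).map
          ((L.forget v ⋙ L.toE v ⋙ L.monoAn ⋙ L.κAnMono.functor).map ((L.lamChain v h).app y)) ≫
        (I.chain v h).app ((L.lam v ν₂ ⋙ L.forget v ⋙ L.toE v ⋙ L.monoAn ⋙ L.κAnMono.functor).obj y) := rfl

/-- ★ **the `η⊢`-square along chains**: GIVEN the edge-indexed square `EtaNaturalAt` (abc-iut-L4-t3), for every `ν₁ ⤳ ν₂` in `Γ⃗×_v`,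
`η⊢_{v,ν₁} ≫ (ι⊞ along the chain ▹ (𝒩⊞_v → 𝒩⊢⊞_v)) = (γ¹-side homotopy along the chain) ≫ η⊢_{v,ν₂}` as natural transformations — the
squares along the edges paste (the exchange of whiskerings is the naturality of `ι^{An⊢⊞}`), the diagonal is trivial; NO square
hypothesis is needed. [cite: MochizukiAbsTopIII2015, Cor 5.10 (iv)(c) p. 148] -/
theorem etaNaturalAt_chain (hEta : I.EtaNaturalAt η) (v : Vmod) {ν₁ ν₂ : LogVertex (isArc v)} (h : ν₁.Reach ν₂) :
    (η v ν₁ h.isCross_src).hom ≫ Functor.whiskerRight (L.lamChain v h) (L.monoNplus v) =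
      I.gammaOneChain v h ≫ (η v ν₂ h.isCross_tgt).hom := by
  refine LogVertex.reachChain_induction₂ (b := isArc v) (fun j => L.lam v j.1) (fun ε hε => L.iotaCore v ε hε)
    (fun j => L.ψAnMono v j) (fun ε hε => I.ι v ε hε)
    (fun j₁ j₂ f g => (η v j₁.1 j₁.2).hom ≫ Functor.whiskerRight f (L.monoNplus v) =
      gammaOneOf (L := L) v (hν₁ := j₁.2) (hν₂ := j₂.2) f g ≫ (η v j₂.1 j₂.2).hom)
    (fun j => ?_) (fun j₁ j₂ j₃ f f' g g' hf hf' => ?_) (fun μ₁ μ₂ ε hε => I.etaNaturalAt_natTrans hEta v ε hε) h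
  · rw [Functor.whiskerRight_id', gammaOneOf_id, Category.comp_id, Category.id_comp]
  · rw [Functor.whiskerRight_comp, gammaOneOf_comp, ← Category.assoc, hf, Category.assoc, hf', Category.assoc]

/-- componentwise form of the square along chains. [cite: MochizukiAbsTopIII2015, Cor 5.10 (iv)(c) p. 148] -/
theorem etaNaturalAt_chain_app (hEta : I.EtaNaturalAt η) (v : Vmod) {ν₁ ν₂ : LogVertex (isArc v)} (h : ν₁.Reach ν₂)
    (y : L.X) :
    (η v ν₁ h.isCross_src).hom.app y ≫ (L.monoNplus v).map ((L.lamChain v h).app y) =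
      (I.gammaOneChain v h).app y ≫ (η v ν₂ h.isCross_tgt).hom.app y :=
  NatTrans.congr_app (I.etaNaturalAt_chain hEta v h) y

/-- **conjugate form along chains**: the `γ¹`-side homotopy along `ν₁ ⤳ ν₂` IS the `η⊢`-conjugate of the mono-analyticised `ι⊞`
along the chain. [cite: MochizukiAbsTopIII2015, Cor 5.10 (iv)(c) p. 148] -/
theorem gammaOneChain_eq_conj (hEta : I.EtaNaturalAt η) (v : Vmod) {ν₁ ν₂ : LogVertex (isArc v)} (h : ν₁.Reach ν₂) :
    I.gammaOneChain v h = (η v ν₁ h.isCross_src).hom ≫ Functor.whiskerRight (L.lamChain v h) (L.monoNplus v) ≫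
      (η v ν₂ h.isCross_tgt).inv := by
  rw [← Category.assoc, I.etaNaturalAt_chain hEta v h, Category.assoc, Iso.hom_inv_id, Category.comp_id]

/-- the inverse form: `η⊢_{v,ν₁}⁻¹ ≫ (γ¹-side homotopy along the chain) ≫ η⊢_{v,ν₂}` is the mono-analyticised `ι⊞` along the chain
(the shape in which the cross post-composition law of the contact structure consumes the square).
[cite: MochizukiAbsTopIII2015, Cor 5.10 (iv)(c) p. 148] -/
theorem eta_inv_comp_gammaOneChain (hEta : I.EtaNaturalAt η) (v : Vmod) {ν₁ ν₂ : LogVertex (isArc v)}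
    (h : ν₁.Reach ν₂) :
    (η v ν₁ h.isCross_src).inv ≫ I.gammaOneChain v h ≫ (η v ν₂ h.isCross_tgt).hom =
      Functor.whiskerRight (L.lamChain v h) (L.monoNplus v) := by
  rw [← I.etaNaturalAt_chain hEta v h, Iso.inv_hom_id_assoc]

/-- componentwise inverse form. [cite: MochizukiAbsTopIII2015, Cor 5.10 (iv)(c) p. 148] -/
theorem eta_inv_comp_gammaOneChain_app (hEta : I.EtaNaturalAt η) (v : Vmod) {ν₁ ν₂ : LogVertex (isArc v)}
    (h : ν₁.Reach ν₂) (y : L.X) :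
    (η v ν₁ h.isCross_src).inv.app y ≫ (I.gammaOneChain v h).app y ≫ (η v ν₂ h.isCross_tgt).hom.app y =
      (L.monoNplus v).map ((L.lamChain v h).app y) :=
  NatTrans.congr_app (I.eta_inv_comp_gammaOneChain hEta v h) y

end IotaAnMono

end LogFrobeniusSetting

end Literature.AnabelianGeometry.AbsoluteAnabelian
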